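import Mathlib.Analysis.Calculus.FDeriv.Analytic
import Mathlib.Analysis.Calculus.FDeriv.Symmetric
import Mathlib.Analysis.Calculus.FDeriv.Mul
import Mathlib.Analysis.Calculus.FDeriv.Pi
import Mathlib.Analysis.Calculus.ContDiff.Operations
import Mathlib.LinearAlgebra.Matrix.Adjugate
import Mathlib.LinearAlgebra.Determinant
import Mathlib.Topology.Instances.Matrix
import HarnessLib

/-!
# The Jacobian determinant is a null Lagrangian (cofactor divergence identity)

Topic `Literature/Analysis/Calculus`. For a `C²` map `f : ℝⁿ → ℝⁿ` (here `ℝⁿ = ι → ℝ` for a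
finite index type `ι`) write `J(x)` for its Jacobian matrix, `J(x)ₖⱼ = ∂ⱼ fₖ(x)`, and
`adj J` for the adjugate (transposed cofactor) matrix, `J · adj J = det J · 1`.

* `sum_fderiv_jacCofactor_eq_zero` — **Piola's identity / divergence-free rows of the
  cofactor matrix**: `∑ⱼ ∂ⱼ (adj J)ⱼᵢ = 0` for every `i` (Evans, *PDE*, §8.1.4.b, Lemma
  "divergence-free rows"; Chang, *Methods in Nonlinear Analysis*, proof of Lemma 3.1.3).
* `sum_fderiv_piolaField` — the **null-Lagrangian (pull-back) identity**: for `G : ℝⁿ → ℝⁿ`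
  differentiable at `f x`, the field `W(x)ⱼ = ∑ᵢ (adj J(x))ⱼᵢ Gᵢ(f x)` satisfies
  `div W (x) = (div G)(f x) · det J(x)` (Chang, Lemma 3.1.3: `d(ω ∘ f) = (dω) ∘ f` for the
  `(n-1)`-form `ω = Σ (-1)^{k-1} G_k dy₁ ∧ … \hat{dy_k} … ∧ dyₙ`; Evans §8.1.4.b Thm. 2).

These are the computational core of the analytic (Heinz–Nagumo) construction of the Brouwer
degree; they are used in `Literature/Analysis/Calculus/PeriodicDivergence.lean` and
`Literature/Topology/Euclidean/PoincareHopfTorus.lean` (index sum of a periodic vector field).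

Implementation: the determinant is packaged as a continuous multilinear map of the rows
(`detRowsCLM`), so that Jacobi's formula for the derivative of a determinant of moving columns
is Mathlib's `HasFDerivAt.multilinear_comp`; the `(j,i)` adjugate entry of `J(x)` is the
determinant of the columns of `J(x)` with the `j`-th replaced by `eᵢ` (`jacCofactor`,
`jacCofactor_eq_adjugate`). Piola's identity is then the cancellation, by symmetry of second
derivatives and the alternating property, of the terms `det(…, ∂ⱼ∂ₖ f, …, eᵢ, …)` paired under
`j ↔ k`. Mathlib (this tree's version) has neither the cofactor divergence identity nor any
degree theory (searched `Piola`, `null Lagrangian`, `adjugate` + `fderiv`). No `sorry`.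

## References

* L. C. Evans, *Partial Differential Equations*, 2nd ed., GSM 19 (2010), §8.1.4.b (null
  Lagrangians; Lemma: divergence-free rows of `cof Du`; Theorem 2). [Evans2010]
* K.-C. Chang, *Methods in Nonlinear Analysis* (2005), §3.1, Lemma 3.1.3 and its proof.
  [Chang2005]
-/

noncomputable section

open Function

namespace Literature.Analysis.Calculus

variable {ι : Type*} [Fintype ι] [DecidableEq ι]

/-! ### The determinant as a continuous multilinear map of the rows -/

/-- The determinant of a real square matrix as a *continuous* multilinear map of its rows
(Mathlib's `Matrix.detRowAlternating` with continuity, which holds because the determinant is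
a polynomial in the entries). [folklore] -/
def detRowsCLM (ι : Type*) [Fintype ι] [DecidableEq ι] :
    ContinuousMultilinearMap ℝ (fun _ : ι => ι → ℝ) ℝ where
  toMultilinearMap := (Matrix.detRowAlternating : (ι → ℝ) [⋀^ι]→ₗ[ℝ] ℝ).toMultilinearMap
  cont := by
    change Continuous fun M : Matrix ι ι ℝ => M.det
    exact continuous_id.matrix_det

/-- `detRowsCLM` is the determinant of the matrix with the given rows. [folklore] -/
@[simp]
theorem detRowsCLM_apply (v : ι → ι → ℝ) : detRowsCLM ι v = Matrix.det (Matrix.of v) := rfl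

/-- Swapping two rows changes the sign of the determinant (alternating property of
`detRowsCLM`). [folklore] -/
theorem detRowsCLM_comp_swap (v : ι → ι → ℝ) {j k : ι} (hjk : j ≠ k) :
    detRowsCLM ι (v ∘ Equiv.swap j k) = -detRowsCLM ι v :=
  (Matrix.detRowAlternating : (ι → ℝ) [⋀^ι]→ₗ[ℝ] ℝ).map_swap v hjk

/-! ### Jacobian matrix and cofactors of a map `ℝⁿ → ℝⁿ` -/

/-- The Jacobian matrix `J(x)ₖⱼ = ∂ⱼ fₖ (x)` of `f : ℝⁿ → ℝⁿ` at `x` (the matrix of the Fréchet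
derivative `fderiv ℝ f x` in the standard basis). [folklore] -/
def jacobianMatrix (f : (ι → ℝ) → ι → ℝ) (x : ι → ℝ) : Matrix ι ι ℝ :=
  LinearMap.toMatrix' (fderiv ℝ f x : (ι → ℝ) →ₗ[ℝ] ι → ℝ)

/-- Entries of the Jacobian matrix. [folklore] -/
@[simp]
theorem jacobianMatrix_apply (f : (ι → ℝ) → ι → ℝ) (x : ι → ℝ) (k j : ι) :
    jacobianMatrix f x k j = fderiv ℝ f x (Pi.single j 1) k := rfl

/-- The determinant of the Jacobian matrix is the determinant of the derivative. [folklore] -/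
theorem det_jacobianMatrix (f : (ι → ℝ) → ι → ℝ) (x : ι → ℝ) :
    (jacobianMatrix f x).det = (fderiv ℝ f x).det :=
  LinearMap.det_toMatrix' _

/-- The columns `∂ⱼ f (x)` of the Jacobian matrix, as a family of vectors. [folklore] -/
def jacCols (f : (ι → ℝ) → ι → ℝ) (x : ι → ℝ) : ι → ι → ℝ :=
  fun j => fderiv ℝ f x (Pi.single j 1)

/-- The determinant of the family of columns is the Jacobian determinant. [folklore] -/
theorem detRowsCLM_jacCols (f : (ι → ℝ) → ι → ℝ) (x : ι → ℝ) :
    detRowsCLM ι (jacCols f x) = (fderiv ℝ f x).det := by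
  rw [← det_jacobianMatrix, ← Matrix.det_transpose]
  rfl

/-- The cofactor `Cᵢⱼ(x) = det (∂₁f, …, eᵢ (slot j), …, ∂ₙ f)`: the determinant of the columns of
the Jacobian with the `j`-th column replaced by the basis vector `eᵢ`; this is the `(j, i)` entry
of the adjugate of `J(x)` (`jacCofactor_eq_adjugate`). [folklore] -/
def jacCofactor (f : (ι → ℝ) → ι → ℝ) (i j : ι) (x : ι → ℝ) : ℝ :=
  detRowsCLM ι (update (jacCols f x) j (Pi.single i 1))

/-- The cofactor `Cᵢⱼ(x)` is the `(j, i)` entry of `adj J(x)`. [folklore] -/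
theorem jacCofactor_eq_adjugate (f : (ι → ℝ) → ι → ℝ) (i j : ι) (x : ι → ℝ) :
    jacCofactor f i j x = (jacobianMatrix f x).adjugate j i := by
  rw [← Matrix.transpose_apply (jacobianMatrix f x).adjugate i j, Matrix.adjugate_transpose,
    Matrix.adjugate_apply]
  rfl

/-- Laplace/Cramer: `∑ⱼ J(x)ₖⱼ Cᵢⱼ(x) = δₖᵢ det J(x)` (`J · adj J = det J · 1`). [folklore] -/
theorem sum_jacobianMatrix_mul_jacCofactor (f : (ι → ℝ) → ι → ℝ) (x : ι → ℝ) (k i : ι) :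
    ∑ j, jacobianMatrix f x k j * jacCofactor f i j x =
      if k = i then (fderiv ℝ f x).det else 0 := by
  simp_rw [jacCofactor_eq_adjugate]
  rw [← Matrix.mul_apply, Matrix.mul_adjugate, Matrix.smul_apply, Matrix.one_apply, smul_eq_mul,
    mul_ite, mul_one, mul_zero, det_jacobianMatrix]

/-! ### An antisymmetry lemma -/

/-- If `s j k = s k j`, the double sum over `j ≠ k` of `det (update (update m j w) k (s j k))`
vanishes: the `(j,k)` and `(k,j)` terms differ by a transposition of two rows. [folklore] -/
theorem sum_sum_detRowsCLM_update_update_eq_zero (m : ι → ι → ℝ) (w : ι → ℝ)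
    (s : ι → ι → ι → ℝ) (hs : ∀ j k, s j k = s k j) :
    ∑ j, ∑ k, (if k = j then 0 else detRowsCLM ι (update (update m j w) k (s j k))) = 0 := by
  set a : ι → ι → ℝ := fun j k =>
    if k = j then 0 else detRowsCLM ι (update (update m j w) k (s j k)) with ha
  have hanti : ∀ j k, a k j = -a j k := by
    intro j k
    by_cases hkj : k = j
    · subst hkj
      simp [a]
    · have hjk : j ≠ k := fun h => hkj h.symm
      have hswap : update (update m k w) j (s k j) = update (update m j w) k (s j k) ∘ Equiv.swap j k := by
        funext l
        simp only [comp_apply]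
        by_cases hlj : l = j
        · subst hlj
          rw [update_self, Equiv.swap_apply_left, update_self, hs]
        · by_cases hlk : l = k
          · subst hlk
            rw [update_of_ne hlj, update_self, Equiv.swap_apply_right, update_of_ne hjk,
              update_self]
          · rw [update_of_ne hlj, update_of_ne hlk, Equiv.swap_apply_of_ne_of_ne hlj hlk,
              update_of_ne hlk, update_of_ne hlj]
      simp only [a, if_neg hkj, if_neg hjk, hswap, detRowsCLM_comp_swap _ hjk]
  have hS : ∑ j, ∑ k, a j k = -∑ j, ∑ k, a j k := by
    conv_rhs => rw [Finset.sum_comm]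
    simp only [← Finset.sum_neg_distrib, ← hanti]
  change ∑ j, ∑ k, a j k = 0
  linarith

/-! ### Piola's identity -/

section Piola

variable {f : (ι → ℝ) → ι → ℝ} {x : ι → ℝ}

/-- The columns `y ↦ ∂ₖ f (y)` of the Jacobian of a map that is `C²` at `x` are differentiable at
`x`, with derivative `v ↦ D²f(x)(v, eₖ)`. [folklore] -/
theorem hasFDerivAt_jacCols (hf : ContDiffAt ℝ 2 f x) (k : ι) :
    HasFDerivAt (fun y => jacCols f y k) ((fderiv ℝ (fderiv ℝ f) x).flip (Pi.single k 1)) x := by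
  have h1 : ContDiffAt ℝ 1 (fderiv ℝ f) x := hf.fderiv_right (by norm_num)
  have h2 : HasFDerivAt (fderiv ℝ f) (fderiv ℝ (fderiv ℝ f) x) x :=
    (h1.differentiableAt one_ne_zero).hasFDerivAt
  have h3 := h2.clm_apply (hasFDerivAt_const (Pi.single k (1 : ℝ)) x)
  simpa [jacCols] using h3

/-- Jacobi's formula for the cofactors: `y ↦ Cᵢⱼ(y)` is differentiable at a point where `f` is
`C²`, with derivative `v ↦ ∑_{k ≠ j} det (update (update (∂f) j eᵢ) k (D²f(x)(v, eₖ)))`.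
[folklore] -/
theorem hasFDerivAt_jacCofactor (hf : ContDiffAt ℝ 2 f x) (i j : ι) :
    HasFDerivAt (jacCofactor f i j)
      (∑ k, (detRowsCLM ι).toContinuousLinearMap (update (jacCols f x) j (Pi.single i 1)) k ∘L
        (if k = j then (0 : (ι → ℝ) →L[ℝ] ι → ℝ)
          else (fderiv ℝ (fderiv ℝ f) x).flip (Pi.single k 1))) x := by
  have hg : ∀ k, HasFDerivAt (fun y => update (jacCols f y) j (Pi.single i (1 : ℝ)) k)
      (if k = j then (0 : (ι → ℝ) →L[ℝ] ι → ℝ)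
        else (fderiv ℝ (fderiv ℝ f) x).flip (Pi.single k 1)) x := by
    intro k
    by_cases hkj : k = j
    · subst hkj
      simp only [update_self, if_true]
      exact hasFDerivAt_const _ _
    · simp only [update_of_ne hkj, if_neg hkj]
      exact hasFDerivAt_jacCols hf k
  exact HasFDerivAt.multilinear_comp (detRowsCLM ι) hg

/-- **Piola's identity** (divergence-free rows of the cofactor matrix; Evans, *PDE* §8.1.4.b,
Lemma; Chang 2005, proof of Lemma 3.1.3): if `f : ℝⁿ → ℝⁿ` is `C²` at `x`, then for every `i`,
`∑ⱼ ∂ⱼ Cᵢⱼ (x) = ∑ⱼ ∂ⱼ (adj J)ⱼᵢ (x) = 0`. Proof: by Jacobi's formula the sum is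
`∑_{j ≠ k} det (update (update (∂f) j eᵢ) k (∂ⱼ∂ₖ f))`, and the `(j,k)` and `(k,j)` terms cancel
by the symmetry `∂ⱼ∂ₖ f = ∂ₖ∂ⱼ f` and the alternating property of the determinant.
[cite: Evans2010, §8.1.4.b Lemma (divergence-free rows)] -/
theorem sum_fderiv_jacCofactor_eq_zero (hf : ContDiffAt ℝ 2 f x) (i : ι) :
    ∑ j, fderiv ℝ (jacCofactor f i j) x (Pi.single j 1) = 0 := by
  have hsymm : IsSymmSndFDerivAt ℝ f x := hf.isSymmSndFDerivAt (by simp)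
  have hcalc : ∀ j, fderiv ℝ (jacCofactor f i j) x (Pi.single j 1) =
      ∑ k, (if k = j then 0 else detRowsCLM ι (update (update (jacCols f x) j (Pi.single i 1)) k
        (fderiv ℝ (fderiv ℝ f) x (Pi.single j 1) (Pi.single k 1)))) := by
    intro j
    rw [(hasFDerivAt_jacCofactor hf i j).fderiv, sum_apply]
    refine Finset.sum_congr rfl fun k _ => ?_
    by_cases hkj : k = j
    · subst hkj
      simp
    · simp [hkj, ContinuousLinearMap.flip_apply]
  simp_rw [hcalc]
  exact sum_sum_detRowsCLM_update_update_eq_zero (jacCols f x) (Pi.single i 1)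
    (fun j k => fderiv ℝ (fderiv ℝ f) x (Pi.single j 1) (Pi.single k 1)) (fun j k => hsymm _ _)

end Piola

/-! ### The null-Lagrangian identity `div (adj J · G∘f) = (div G)∘f · det J` -/

section NullLagrangian

variable {f G : (ι → ℝ) → ι → ℝ} {x : ι → ℝ}

/-- The **Piola field** of `f` and `G`: `W(x)ⱼ = ∑ᵢ Cᵢⱼ(x) Gᵢ(f x) = (adj J(x) · G(f x))ⱼ`, the
coefficient vector of the pulled-back `(n-1)`-form `f^*(Σᵢ (-1)^{i-1} Gᵢ dy₁ ∧ ⋯ \hat{dyᵢ} ⋯ ∧ dyₙ)`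
(Chang 2005, proof of Lemma 3.1.3). [folklore] -/
def piolaField (f G : (ι → ℝ) → ι → ℝ) (x : ι → ℝ) : ι → ℝ :=
  fun j => ∑ i, jacCofactor f i j x * G (f x) i

omit [DecidableEq ι] in
/-- Components of `G ∘ f` are differentiable, with the chain-rule derivative. [folklore] -/
theorem hasFDerivAt_comp_apply (hf : DifferentiableAt ℝ f x) (hG : DifferentiableAt ℝ G (f x))
    (i : ι) :
    HasFDerivAt (fun y => G (f y) i)
      ((ContinuousLinearMap.proj i).comp ((fderiv ℝ G (f x)).comp (fderiv ℝ f x))) x :=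
  hasFDerivAt_pi'.1 (hG.hasFDerivAt.comp x hf.hasFDerivAt) i

/-- The Piola field is differentiable at a point where `f` is `C²` and `G` is differentiable at
`f x` (product and chain rules). [folklore] -/
theorem hasFDerivAt_piolaField (hf : ContDiffAt ℝ 2 f x) (hG : DifferentiableAt ℝ G (f x)) :
    HasFDerivAt (piolaField f G)
      (ContinuousLinearMap.pi fun j => ∑ i,
        (jacCofactor f i j x •
            (ContinuousLinearMap.proj i).comp ((fderiv ℝ G (f x)).comp (fderiv ℝ f x)) +
          G (f x) i • fderiv ℝ (jacCofactor f i j) x)) x := by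
  have hfd : DifferentiableAt ℝ f x := hf.differentiableAt (by norm_num)
  apply hasFDerivAt_pi.2
  intro j
  exact HasFDerivAt.fun_sum fun i _ =>
    ((hasFDerivAt_jacCofactor hf i j).differentiableAt.hasFDerivAt).fun_mul
      (hasFDerivAt_comp_apply hfd hG i)

/-- In coordinates, `(DG(y) v)ᵢ = ∑ₖ J_G(y)ᵢₖ vₖ`. [folklore] -/
theorem fderiv_apply_eq_sum_jacobianMatrix (G : (ι → ℝ) → ι → ℝ) (y v : ι → ℝ) (i : ι) :
    fderiv ℝ G y v i = ∑ k, jacobianMatrix G y i k * v k := by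
  conv_lhs => rw [← Finset.univ_sum_single v]
  rw [map_sum, Finset.sum_apply]
  refine Finset.sum_congr rfl fun k _ => ?_
  have hk : (Pi.single k (v k) : ι → ℝ) = v k • (Pi.single k (1 : ℝ) : ι → ℝ) := by
    ext l
    by_cases h : l = k
    · subst h; simp
    · simp [h]
  rw [jacobianMatrix_apply, hk, map_smul, Pi.smul_apply, smul_eq_mul, mul_comm]

/-- **The Jacobian determinant is a null Lagrangian** (Chang 2005, Lemma 3.1.3,
`d(ω ∘ f) = (dω) ∘ f`; Evans, *PDE* §8.1.4.b, Theorem 2): if `f : ℝⁿ → ℝⁿ` is `C²` at `x` and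
`G : ℝⁿ → ℝⁿ` is differentiable at `f x`, then the Piola field `W = adj J · (G ∘ f)` satisfies
`div W (x) = (div G)(f x) · det J(x)`, i.e.
`∑ⱼ ∂ⱼ Wⱼ (x) = (∑ᵢ ∂ᵢ Gᵢ)(f x) · det Df(x)`. Proof: product and chain rules, Piola's identity
`∑ⱼ ∂ⱼ Cᵢⱼ = 0` and `∑ⱼ Jₖⱼ Cᵢⱼ = δₖᵢ det J`. [cite: Chang2005, Lemma 3.1.3] -/
theorem sum_fderiv_piolaField (hf : ContDiffAt ℝ 2 f x) (hG : DifferentiableAt ℝ G (f x)) :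
    ∑ j, fderiv ℝ (piolaField f G) x (Pi.single j 1) j =
      (∑ i, fderiv ℝ G (f x) (Pi.single i 1) i) * (fderiv ℝ f x).det := by
  rw [(hasFDerivAt_piolaField hf hG).fderiv]
  simp only [ContinuousLinearMap.pi_apply, FunLike.coe_sum, Finset.sum_apply, add_apply,
    FunLike.coe_smul, Pi.smul_apply, ContinuousLinearMap.coe_comp, comp_apply,
    ContinuousLinearMap.proj_apply, smul_eq_mul]
  rw [Finset.sum_comm, Finset.sum_mul]
  refine Finset.sum_congr rfl fun i _ => ?_
  rw [Finset.sum_add_distrib]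
  -- the second sum vanishes by Piola's identity
  have h2 : ∑ j, G (f x) i * fderiv ℝ (jacCofactor f i j) x (Pi.single j 1) = 0 := by
    rw [← Finset.mul_sum, sum_fderiv_jacCofactor_eq_zero hf i, mul_zero]
  rw [h2, add_zero]
  -- the first sum is `∂ᵢ Gᵢ (f x) · det J(x)` by `J · adj J = det J · 1`
  have h4 : ∀ j, fderiv ℝ G (f x) (fderiv ℝ f x (Pi.single j 1)) i =
      ∑ k, jacobianMatrix G (f x) i k * jacobianMatrix f x k j := fun j => by
    rw [fderiv_apply_eq_sum_jacobianMatrix]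
    rfl
  simp_rw [h4]
  calc ∑ j, jacCofactor f i j x * ∑ k, jacobianMatrix G (f x) i k * jacobianMatrix f x k j
      = ∑ k, jacobianMatrix G (f x) i k * ∑ j, jacobianMatrix f x k j * jacCofactor f i j x := by
        simp_rw [Finset.mul_sum]
        rw [Finset.sum_comm]
        exact Finset.sum_congr rfl fun k _ => Finset.sum_congr rfl fun j _ => by ring
    _ = ∑ k, jacobianMatrix G (f x) i k * (if k = i then (fderiv ℝ f x).det else 0) := by
        simp_rw [sum_jacobianMatrix_mul_jacCofactor]
    _ = jacobianMatrix G (f x) i i * (fderiv ℝ f x).det := by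
        simp_rw [mul_ite, mul_zero, Finset.sum_ite_eq', Finset.mem_univ, if_true]
    _ = fderiv ℝ G (f x) (Pi.single i 1) i * (fderiv ℝ f x).det := by
        rw [jacobianMatrix_apply]

end NullLagrangian

end Literature.Analysis.Calculus
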